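import Summits.HodgeConjecture.HodgeConjecture.Theorems.HeckePrymWeilHeckePrymAnchorsOfSections
import Summits.HodgeConjecture.HodgeConjecture.Theorems.HeckePrymWeilHeckePrymAnchorsGlobalClassOfLeray
import Summits.HodgeConjecture.HodgeConjecture.Theorems.HeckePrymWeilHeckePrymAnchorsRationalAlongSection
import Literature.AlgebraicGeometry.HodgeTheory.WeilFamilyFlatSections
import Literature.AlgebraicGeometry.HodgeTheory.GlobalInvariantCycles
import HarnessLib

/-!
# `HeckePrymAnchors` modulo three named facts: Deligne 1968, Charles–Schnell 11.3.5 (1), the Weil family (item stmt-HodgeConjecture-14496, route HeckePrymWeil)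

Line `Sketch`, v5 (continuation lead c2). The accepted v4 result `heckePrymAnchors_of_facts`
(`…HeckePrymAnchorsOfFacts`) derived the crux from FOUR named facts of the tree: the partie fixe
`deligne_globalInvariantCycles` (Hodge II 4.1.1), the body of `Hironaka1964_smoothCompactification`,
`charlesSchnell_hodgeClass_of_flat` (Charles–Schnell Prop. 11.3.5 (1)) and the Weil family
`deligne1982_weilFamily_flatWeilSection`. This file removes the first two: the W-engine of the line
(one global class of the OPEN total space restricting to a given flat section) follows from the
INPUT of the partie fixe's own printed proof — Deligne 1968, degeneration of the Leray spectral
sequence of a projective submersion, in the pointwise form of Voisin II Thm. 4.18 (the tree's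
hypothesis shape `h418` of `deligne_globalInvariantCycles_of_thm418_of_cor3217`, here with the
projectivity of `f` explicit: quasi-projective total space) — by the landed
`stub_globalClassOfSection_of_leray`; no compactification (Hironaka) and no mixed Hodge theory.

* `weilFamilyHodge_of_charlesSchnell` — PROVED: Charles–Schnell 11.3.5 (1) upgrades the Weil-family
  package to the package WITH fibrewise Hodge type of the flat section (the shape consumed by the
  landed composition `heckePrymAnchors_of_sections`; it is Deligne's clause (a) of the proof of
  LNM 900 Thm. 4.8, filed separately as the named fact `deligne1982_weilFamily_hodgeWeilSection`):
  rationality propagates along the section (`stub_rationalAlongSection`, proved), the base is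
  connected (`owf_connectedSpace_complexPoints`), and the section is a Hodge class at `s₁`.
* `heckePrymAnchors_of_three_facts` — the crux from (Deligne 1968, spelled out verbatim) +
  `charlesSchnell_hodgeClass_of_flat` + `deligne1982_weilFamily_flatWeilSection`; CONDITIONAL on
  exactly these three published theorems.

No definition, no `sorry`.
-/

noncomputable section

-- every declaration of this problem lives in `Summit.HodgeConjecture.HodgeConjecture.…` (summit = sub-problem)
set_option linter.dupNamespace false

open CategoryTheory AlgebraicGeometry Limits MonoidalCategory CartesianMonoidalCategory

namespace Summit.HodgeConjecture.HodgeConjecture.Theorems.HeckePrymWeilLine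

open Literature.AlgebraicGeometry Literature.AlgebraicGeometry.Motives Literature.AlgebraicGeometry.HodgeTheory
open Summit.HodgeConjecture.HodgeConjecture.Theses.HeckePrymWeil

/-- **Charles–Schnell 11.3.5 (1) upgrades the Weil family to the fibrewise-Hodge package.** Given
`charlesSchnell_hodgeClass_of_flat` (a flat rational section that is a Hodge class at one point is a
Hodge class everywhere) and the Weil-family package `deligne1982_weilFamily_flatWeilSection`, the
same family, points, section and tensor-split fibre satisfy in addition: the value `σ(s)` is of
Hodge type `(k,k)` on EVERY fibre. Proof: `σ(s₁) = (s₁, e^{-1 *} c)` is rational of type `(k,k)`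
(transport along `e`), rationality propagates along `σ` (`stub_rationalAlongSection`), `S(ℂ)` is
connected (`owf_connectedSpace_complexPoints`), so 11.3.5 (1) applies at every `s`.
[cite: CharlesSchnell2014Notes, Proposition 11.3.5 (1)] [cite: Deligne1982HodgeCycles, proof of Thm. 4.8] -/
theorem weilFamilyHodge_of_charlesSchnell :
    (charlesSchnell_hodgeClass_of_flat) → (deligne1982_weilFamily_flatWeilSection) → ∀ p : ℕ, p.Prime → p % 4 = 3 → 7 ≤ p → ∀ (k : ℕ), 1 ≤ k → ∀ (X : AbelianVariety ℂ) (Φ : X ⟶ X), X.dim = 2 * k → Φ ≫ Φ = -((p : ℤ) • 𝟙 X) → ∀ c : complexBetti X.X (2 * k), c ∈ weilClassesOf X Φ k p → c ≠ 0 → IsRationalClass c → IsOfHodgeType (2 * k) X.X (2 * k) k k c → ∃ (𝒳 S : SchemeOver ℂ) (f : 𝒳 ⟶ S) (s₁ s₀ : ComplexPoints S) (e : X.X ≅ fiberOver f s₁) (σ : ComplexPoints S → FiberClass f (2 * k)), IsSmoothProjectiveFamily f (2 * k) ∧ (∃ (N : ℕ) (ι : 𝒳 ⟶ projectiveSpace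 N ℂ ⊗ S), IsClosedImmersion ι.left ∧ ι ≫ snd (projectiveSpace N ℂ) S = f) ∧ IrreducibleSpace S.left ∧ AlgebraicGeometry.Smooth S.hom ∧ IsQuasiProjectiveOver S ∧ (∀ s : ComplexPoints S, ∃ (A' : AbelianVariety ℂ) (φ' : A' ⟶ A'), A'.dim = 2 * k ∧ φ' ≫ φ' = -((p : ℤ) • 𝟙 A') ∧ Nonempty (A'.X ≅ fiberOver f s)) ∧ Continuous σ ∧ (∀ s, (σ s).pt = s) ∧ (∀ s, IsOfHodgeType (2 * k) (fiberOver f (σ s).pt) (2 * k) k k (σ s).cls) ∧ σ s₁ = ⟨s₁, complexBetti.map e.inv (2 * k) c⟩ ∧ ∃ (Y : AbelianVariety ℂ) (Ψ : Y ⟶ Y) (e₀ : Y.X ≅ fiberOver f s₀) (x : complexBetti (fiberOver f s₀) (2 * k)), (∃ (A₁ : AbelianVariety ℂ) (f₁ : Y ⟶ A₁.prod A₁) (g₁ : A₁.prod A₁ ⟶ Y) (m : ℕ), A₁.dim = k ∧ Y.dim = 2 * k ∧ Ψ ≫ Ψ = -((p : ℤ) • 𝟙 Y) ∧ 0 < m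 ∧ f₁ ≫ g₁ = m • 𝟙 Y ∧ Flat f₁.hom.hom.hom.left ∧ g₁ ≫ Ψ = AbelianVariety.prodLift (AbelianVariety.snd A₁ A₁ ≫ (-((p : ℤ) • 𝟙 A₁))) (AbelianVariety.fst A₁ A₁) ≫ g₁) ∧ σ s₀ = ⟨s₀, x⟩ ∧ complexBetti.map e₀.hom (2 * k) x ∈ weilClassesOf Y Ψ k p := by
  intro hCS hWF p hp hp4 hp7 k hk X Φ hX hΦ c hc hc0 hrat hH
  obtain ⟨𝒳, S, f, s₁, s₀, e, σ, hfam, hι, hirr, hsm, hSqp, hfib, hσ, hpt, hs₁, hrest⟩ :=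
    hWF p hp hp4 hp7 k hk X Φ hX hΦ c hc hc0 hrat hH
  -- rationality along the section, from rationality of `c` at `s₁`
  have hrat₁ : IsRationalClass (σ s₁).cls := by
    rw [hs₁]; exact hrat.map _
  have hratσ : ∀ s, IsRationalClass (σ s).cls :=
    stub_rationalAlongSection f (2 * k) (2 * k) hfam hsm hSqp hirr σ hσ hpt s₁ hrat₁
  -- the section is a Hodge class at `s₁`, hence everywhere (Charles–Schnell 11.3.5 (1))
  have hconn : ConnectedSpace (ComplexPoints S) := owf_connectedSpace_complexPoints hSqp hirr
  have hloc₁ : σ s₁ ∈ locusOfHodgeClasses f (2 * k) k := by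
    rw [hs₁, mem_locusOfHodgeClasses_iff]
    exact ⟨hrat.map _, hH.map_of_iso e.symm⟩
  have hHσ : ∀ s, IsOfHodgeType (2 * k) (fiberOver f (σ s).pt) (2 * k) k k (σ s).cls := fun s =>
    ((mem_locusOfHodgeClasses_iff (σ s)).1
      (hCS 𝒳 S f (2 * k) k hfam hSqp hsm hconn σ hσ hpt hratσ s₁ hloc₁ s)).2
  exact ⟨𝒳, S, f, s₁, s₀, e, σ, hfam, hι, hirr, hsm, hSqp, hfib, hσ, hpt, hHσ, hs₁, hrest⟩

/-- **`HeckePrymAnchors` from three named facts** (CONDITIONAL result): Deligne 1968 / Voisin II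
Thm. 4.18 (invariant classes come from the total space; spelled out verbatim — the named fact
`HodgeTheory.deligne1968_invariantClass_fromTotalSpace` of `Literature/…/InvariantClassesFromTotalSpace`),
Charles–Schnell Prop. 11.3.5 (1) `charlesSchnell_hodgeClass_of_flat`, and Deligne's Weil family with
a flat Weil section and a tensor-split fibre `deligne1982_weilFamily_flatWeilSection`. Compared with
the v4 result `heckePrymAnchors_of_facts`, the partie fixe (Hodge II 4.1.1) is replaced by the input
of its own proof and Hironaka's compactification is gone. Proof: the landed composition
`heckePrymAnchors_of_sections`, fed by the landed W-engine `stub_globalClassOfSection_of_leray` and by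
`weilFamilyHodge_of_charlesSchnell`. [cite: Deligne1968, Prop. (2.1) with (2.6.3)]
[cite: VoisinHodgeII2003, Thm. 4.18] [cite: CharlesSchnell2014Notes, Prop. 11.3.5 (1)]
[cite: Deligne1982HodgeCycles, proof of Thm. 4.8 (pp. 47–52), Lemma 4.5, Remark 4.10] -/
theorem heckePrymAnchors_of_three_facts :
    (∀ (𝒳 S : SchemeOver ℂ) (f : 𝒳 ⟶ S) (n : ℕ), IsSmoothProjectiveFamily f n → IsQuasiProjectiveOver 𝒳 → IsQuasiProjectiveOver S → AlgebraicGeometry.Smooth S.hom → ∀ (k : ℕ) (σ : ComplexPoints S → FiberClass f k), Continuous σ → (∀ s, (σ s).pt = s) → ∀ s₀ : ComplexPoints S, ∃ β : complexBetti 𝒳 k, σ s₀ = globalSection f k β s₀) → (charlesSchnell_hodgeClass_of_flat) → (deligne1982_weilFamily_flatWeilSection) → Summit.HodgeConjecture.HodgeConjecture.Theses.HeckePrymWeil.HeckePrymAnchors :=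
  fun hL hCS hWF =>
    heckePrymAnchors_of_sections (stub_globalClassOfSection_of_leray hL)
      (weilFamilyHodge_of_charlesSchnell hCS hWF)

end Summit.HodgeConjecture.HodgeConjecture.Theorems.HeckePrymWeilLine

end
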